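import Mathlib.FieldTheory.LinearDisjoint
import Literature.NumberTheory.ComplexMultiplication.SlotwiseIndependentOfLinearlyDisjoint
import Literature.NumberTheory.ComplexMultiplication.CMFieldConjSquareQuadraticSubfields
import HarnessLib

/-!
# An imaginary quadratic field FOREIGN to a number field `K` (`k ↪̸ K`): the automorphisms of `ℂ` fixing `k` act
# TRANSITIVELY on `Hom(K, ℂ)`, so `ℚ^{Hom(K, ℂ)}` carries no eigenvector for the quadratic character of `k`

Companion of `NumberTheory/ComplexMultiplication/CMTypeRankCommonConstituent` (the pairwise "no common constituent"
criterion for the rank of a family of CM types, with the sufficient condition `pairwise_of_eigenvector`: a slot on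
which the Galois module `U(Φ_i)` is `χ`-isotypic has no common constituent with a slot whose `U(Φ_j)` has no
`χ`-eigenvector) and of `…/SharedImaginaryQuadraticDegenerate`, `…/SharedImaginaryQuadraticFamilies` (two CM fields
SHARING an imaginary quadratic field give a DEGENERATE family).  This file supplies the converse side at the level of
fields, for the COR-CM cell of the Hodge summit (`pub-hodgecm2`, binder seat b16): Moonen–Zarhin's case analysis for an
elliptic curve `X₁` with complex multiplication by `k` times a simple abelian threefold `X₂` — exceptional Hodge classes
iff "there exists an embedding `k ↪ End⁰(X₂)`" [MoonenZarhin1999LowDim, Thm. (0.2) (a) versus (4)] — rests, in the CM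
case, on the following two facts.

* §1 (abstract; a group `G` acting on a set `X`, a function `χ : G → ℚ`): if the elements `h` with `χ(h) = 1` act
  TRANSITIVELY on `X`, every `χ`-eigenvector `f : X → ℚ` (`f ∘ g = χ(g) f`) is constant
  (`apply_eq_apply_of_eigen_of_transitive`), hence ZERO as soon as `χ` takes a value `≠ 1`
  (`eq_zero_of_eigen_of_transitive`) — the mechanism of [MoonenZarhin1999LowDim, Cor. (3.9)] / [Gordon1999HodgeAVSurvey,
  §3 Theorem (proof)] ("acts as `+1` on `X(K^×_{1,1})` and `−1` on the other components") read for ONE quadratic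
  character against a transitive kernel.
* §2 (number fields `k`, `K` with `[k : ℚ] = 2`): **`exists_ringEquiv_smul_eq_of_isEmpty`** — if `k` does NOT embed in
  `K` (`IsEmpty (k →+* K)`), then for all `s, t : K →+* ℂ` some `τ ∈ Aut(ℂ)` fixes every embedding of `k` and maps
  `s` to `t`: the stabiliser of `Hom(k, ℂ)` in `Aut(ℂ)` acts transitively on `Hom(K, ℂ)`.  Proof: the Galois closure
  `L_k = ι(k)` of `k` in `ℂ` has prime degree `2`, so `L_k ∩ s(K)` is `ℚ` or `L_k`; the latter would embed `k` in `K`;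
  hence `L_k` and `s(K)` are linearly disjoint (Mathlib `IntermediateField.LinearDisjoint.of_inf_eq_bot`, `L_k` Galois),
  and the tree's engine `exists_ringEquiv_apply_eq_of_linearDisjoint'` (an automorphism of `ℂ` prescribed independently
  on two linearly disjoint finite subfields: `K ⊗_ℚ k ≅ K·k` is a field) turns any `g ∈ Aut(ℂ)` with `g ∘ s = t`
  (`Motives.ZarhinLie.exists_ringEquiv_complex_comp_eq`) into a `τ` which is `g` on `s(K)` and the identity on `L_k`.
  Conversely (`isEmpty_ringHom_of_forall_exists_smul_eq`) transitivity of that stabiliser forces `k ↪̸ K` when `k` is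
  totally complex — the condition is sharp ([Lang2002, VIII §3–§4]: `K ⊗_ℚ k` is a field iff `k ∩ K = ℚ` for `k/ℚ`
  Galois).

The `Aut(ℂ)`-action on embeddings is the tree's scoped `ringEquivCompAction` (`g • j = g ∘ j`,
`NumberTheory/ComplexMultiplication/EmbeddingAction`).  Everything is proved; no definition, no named fact, no `sorry`.
Consumer: `Summits/HodgeConjecture/CorCM/ForeignQuadraticCMFieldsHodge` (the third menu for the pairwise criterion:
an imaginary quadratic slot foreign to `K_b` has no common constituent with slot `b`).

## References

* [MoonenZarhin1999LowDim] B. Moonen, Yu. Zarhin, *Hodge classes on abelian varieties of low dimension*, Math. Ann.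
  315 (1999) 711–733, Thm. (0.2) (a)/(4) ("`X₁` is an elliptic curve with complex multiplication by an imaginary quadratic
  field `k` and `X₂` is a simple abelian threefold such that there exists an embedding `k ↪ End⁰(X₂)`"), Cor. (3.9).
* [Gordon1999HodgeAVSurvey] B. B. Gordon, *A survey of the Hodge conjecture for abelian varieties*, §3 Theorem (Imai,
  Murty) and its proof.
* [Lang2002] S. Lang, *Algebra*, 3rd ed., GTM 211, V §2 Thm. 2.8 (extension of embeddings), VI §1 Thm. 1.12/1.14,
  VIII §3–§4 (linear disjointness).
-/

noncomputable section

open IntermediateField Module NumberField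

namespace Literature.NumberTheory.ComplexMultiplication

/-! ### §1 Eigenvectors for a character whose kernel acts transitively -/

section Abstract

variable {G : Type*} [Group G] {X : Type*} [MulAction G X]

/-- **A `χ`-eigenvector is constant along a transitive `χ`-kernel**: if `f ∘ g = χ(g) f` for all `g ∈ G` and any two
points of `X` are joined by some `h` with `χ(h) = 1`, then `f` is constant. [cite: MoonenZarhin1999LowDim, Cor. (3.9) (proof)] -/
theorem apply_eq_apply_of_eigen_of_transitive (χ : G → ℚ) {f : X → ℚ}
    (heig : ∀ g : G, (fun x => f (g • x)) = χ g • f) (htrans : ∀ x y : X, ∃ h : G, χ h = 1 ∧ h • x = y)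
    (x y : X) : f x = f y := by
  obtain ⟨h, hχ, hxy⟩ := htrans x y
  have e := congrFun (heig h) x
  simp only [Pi.smul_apply, smul_eq_mul, hχ, one_mul] at e
  rw [← hxy, e]

/-- **No `χ`-eigenvector under a transitive `χ`-kernel**: if moreover `χ(g₀) ≠ 1` for some `g₀`, then `f = 0`
(`f` is constant, and `f(g₀ x) = χ(g₀) f(x)` forces the constant to vanish) — Gordon's "acts as `+1` on one component
and `−1` on the other" for a single quadratic character. [cite: Gordon1999HodgeAVSurvey, §3 Theorem (proof)] -/
theorem eq_zero_of_eigen_of_transitive (χ : G → ℚ) {f : X → ℚ}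
    (heig : ∀ g : G, (fun x => f (g • x)) = χ g • f) (htrans : ∀ x y : X, ∃ h : G, χ h = 1 ∧ h • x = y)
    {g₀ : G} (hg₀ : χ g₀ ≠ 1) : f = 0 := by
  refine funext fun x => ?_
  show f x = 0
  have e := congrFun (heig g₀) x
  simp only [Pi.smul_apply, smul_eq_mul] at e
  rw [apply_eq_apply_of_eigen_of_transitive χ heig htrans (g₀ • x) x] at e
  have h1 : (1 - χ g₀) * f x = 0 := by rw [sub_mul, one_mul, ← e, sub_self]
  exact (mul_eq_zero.1 h1).resolve_left (sub_ne_zero.2 (Ne.symm hg₀))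

end Abstract

/-! ### §2 The stabiliser of a foreign imaginary quadratic field acts transitively on `Hom(K, ℂ)` -/

section Engine

variable {k K : Type} [Field k] [NumberField k] [Field K] [NumberField K]

/-- If the Galois closure of `k` in `ℂ` lies in the image `s(K)` of an embedding of `K`, then `k` embeds in `K`.
[folklore] -/
private theorem nonempty_ringHom_of_normalClosure_le_fieldRange₇ (s : K →+* ℂ)
    (h : normalClosure ℚ k ℂ ≤ s.toRatAlgHom.fieldRange) : Nonempty (k →+* K) := by
  obtain ⟨u⟩ : Nonempty (k →+* ℂ) := inferInstance
  have hu : ∀ x : k, u x ∈ s.toRatAlgHom.range := fun x =>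
    (AlgHom.mem_range _).2 (AlgHom.mem_fieldRange.1
      (h (apply_mem_normalClosure (I := Unit) (K := fun _ => k) () u x)))
  let incl : k →+* ↥s.toRatAlgHom.range :=
    { toFun := fun x => ⟨u x, hu x⟩
      map_one' := Subtype.ext (map_one u)
      map_mul' := fun x y => Subtype.ext (map_mul u x y)
      map_zero' := Subtype.ext (map_zero u)
      map_add' := fun x y => Subtype.ext (map_add u x y) }
  exact ⟨(AlgEquiv.ofInjectiveField s.toRatAlgHom).symm.toRingEquiv.toRingHom.comp incl⟩

/-- A subfield of a finite extension (inside `ℂ`) is finite. [folklore] -/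
private theorem finiteDimensional_of_le₇ {E E' : IntermediateField ℚ ℂ} [FiniteDimensional ℚ E] (h : E' ≤ E) :
    FiniteDimensional ℚ E' :=
  FiniteDimensional.of_injective (IntermediateField.inclusion h).toLinearMap (IntermediateField.inclusion_injective h)

/-- The image of an embedding of a number field is finite over `ℚ`. [folklore] -/
private theorem finiteDimensional_fieldRange₇ (s : K →+* ℂ) : FiniteDimensional ℚ s.toRatAlgHom.fieldRange :=
  LinearEquiv.finiteDimensional (AlgEquiv.ofInjectiveField s.toRatAlgHom).toLinearEquiv

/-- **`ι(k) ∩ s(K) = ℚ` for `k` imaginary quadratic (indeed any quadratic `k`) not embedding in `K`**: the Galois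
closure of `k` in `ℂ` has prime degree `2`, so its intersection with `s(K)` is `ℚ` or all of `ι(k)`, and the latter
would embed `k` in `K`. [cite: Lang2002, VI §1 Thm. 1.12] -/
theorem normalClosure_inf_fieldRange_eq_bot_of_isEmpty (hk : finrank ℚ k = 2) (he : IsEmpty (k →+* K))
    (s : K →+* ℂ) : normalClosure ℚ k ℂ ⊓ s.toRatAlgHom.fieldRange = ⊥ := by
  haveI : Algebra.IsQuadraticExtension ℚ k := ⟨hk⟩
  have hA : finrank ℚ (normalClosure ℚ k ℂ) = 2 := by rw [finrank_normalClosure_of_normal, hk]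
  by_contra hne
  have hle : normalClosure ℚ k ℂ ⊓ s.toRatAlgHom.fieldRange ≤ normalClosure ℚ k ℂ := inf_le_left
  haveI : FiniteDimensional ℚ ↥(normalClosure ℚ k ℂ ⊓ s.toRatAlgHom.fieldRange) := finiteDimensional_of_le₇ hle
  have h1 : finrank ℚ ↥(normalClosure ℚ k ℂ ⊓ s.toRatAlgHom.fieldRange) ≠ 1 := fun h =>
    hne (IntermediateField.finrank_eq_one_iff.1 h)
  have hpos : 0 < finrank ℚ ↥(normalClosure ℚ k ℂ ⊓ s.toRatAlgHom.fieldRange) := finrank_pos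
  have h2 : finrank ℚ (normalClosure ℚ k ℂ) ≤ finrank ℚ ↥(normalClosure ℚ k ℂ ⊓ s.toRatAlgHom.fieldRange) := by
    rw [hA]; omega
  have heq := IntermediateField.eq_of_le_of_finrank_le hle h2
  have hAB : normalClosure ℚ k ℂ ≤ s.toRatAlgHom.fieldRange := by
    rw [← heq]; exact inf_le_right
  exact he.false (Classical.choice (nonempty_ringHom_of_normalClosure_le_fieldRange₇ s hAB))

/-- **`ι(k)` and `s(K)` are linearly disjoint over `ℚ`** (`K ⊗_ℚ k ≅ s(K)·ι(k)` is a field) when the quadratic field `k`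
does not embed in `K`. [cite: Lang2002, VIII §3–§4 and VI §1 Thm. 1.14] -/
theorem linearDisjoint_normalClosure_fieldRange_of_isEmpty (hk : finrank ℚ k = 2) (he : IsEmpty (k →+* K))
    (s : K →+* ℂ) : (normalClosure ℚ k ℂ).LinearDisjoint s.toRatAlgHom.fieldRange := by
  haveI hG : IsGalois ℚ ↥(normalClosure ℚ k ℂ) := isGalois_normalClosure_complex (I := Unit) (K := fun _ => k) ()
  haveI : FiniteDimensional ℚ s.toRatAlgHom.fieldRange := finiteDimensional_fieldRange₇ s
  exact @IntermediateField.LinearDisjoint.of_inf_eq_bot ℚ ℂ _ _ _ _ _ hG inferInstance inferInstance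
    (normalClosure_inf_fieldRange_eq_bot_of_isEmpty hk he s)

/-- **The stabiliser of a foreign quadratic field acts transitively on `Hom(K, ℂ)`.**  Let `[k : ℚ] = 2` and suppose `k`
does not embed in `K`.  Then for all embeddings `s, t : K → ℂ` there is `τ ∈ Aut(ℂ)` with `τ ∘ u = u` for EVERY
embedding `u : k → ℂ` and `τ ∘ s = t` (an automorphism prescribed independently on the linearly disjoint fields `ι(k)`
and `s(K)`, extended from the countable field `s(K)·ι(k)` to `ℂ`) — the CM form of Moonen–Zarhin's hypothesis "there is
NO embedding `k ↪ End⁰(X₂)`". [cite: MoonenZarhin1999LowDim, Thm. (0.2) (a)/(4)] [cite: Lang2002, V §2 Thm. 2.8 and VI §1 Thm. 1.14] -/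
theorem exists_ringEquiv_smul_eq_of_isEmpty (hk : finrank ℚ k = 2) (he : IsEmpty (k →+* K)) (s t : K →+* ℂ) :
    ∃ τ : ℂ ≃+* ℂ, (∀ u : k →+* ℂ, τ • u = u) ∧ τ • s = t := by
  haveI : Countable K := Countable.of_equiv _ (Module.finBasis ℚ K).equivFun.toEquiv.symm
  obtain ⟨g, hg⟩ := Literature.AlgebraicGeometry.Motives.ZarhinLie.exists_ringEquiv_complex_comp_eq s t
  haveI : FiniteDimensional ℚ s.toRatAlgHom.fieldRange := finiteDimensional_fieldRange₇ s
  obtain ⟨τ, hτA, hτB⟩ :=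
    exists_ringEquiv_apply_eq_of_linearDisjoint' (linearDisjoint_normalClosure_fieldRange_of_isEmpty hk he s) g
  refine ⟨τ, fun u => RingHom.ext fun x => ?_, RingHom.ext fun x => ?_⟩
  · rw [ringEquiv_smul_apply]
    exact hτA (u x) (apply_mem_normalClosure (I := Unit) (K := fun _ => k) () u x)
  · rw [ringEquiv_smul_apply, hτB (s x) (AlgHom.mem_fieldRange.2 ⟨x, rfl⟩), hg x]

/-- Variant with a prescribed automorphism on `k`: for `g ∈ Aut(ℂ)` and `s, t : K → ℂ` some `τ ∈ Aut(ℂ)` acts as `g` on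
every embedding of `k` and maps `s` to `t` (compose the transitive stabiliser with `g`). [cite: MoonenZarhin1999LowDim, Thm. (0.2) (a)/(4)]
[cite: Lang2002, VI §1 Thm. 1.14] -/
theorem exists_ringEquiv_smul_eq_smul_eq_of_isEmpty (hk : finrank ℚ k = 2) (he : IsEmpty (k →+* K)) (g : ℂ ≃+* ℂ)
    (s t : K →+* ℂ) : ∃ τ : ℂ ≃+* ℂ, (∀ u : k →+* ℂ, τ • u = g • u) ∧ τ • s = t := by
  obtain ⟨τ, hτu, hτs⟩ := exists_ringEquiv_smul_eq_of_isEmpty hk he (g • s) t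
  refine ⟨τ * g, fun u => ?_, ?_⟩
  · rw [mul_smul, hτu (g • u)]
  · rw [mul_smul, hτs]

omit [NumberField k] in
/-- **Sharpness**: if `k` is totally complex and the stabiliser of `Hom(k, ℂ)` in `Aut(ℂ)` acts transitively on
`Hom(K, ℂ)`, then `k` does not embed in `K` (an embedding `j` would make `s ↦ s ∘ j` equivariant, but `s` and `s̄` have
conjugate restrictions). [cite: MoonenZarhin1999LowDim, Thm. (0.2) (a)] -/
theorem isEmpty_ringHom_of_forall_exists_smul_eq [IsTotallyComplex k]
    (h : ∀ s t : K →+* ℂ, ∃ τ : ℂ ≃+* ℂ, (∀ u : k →+* ℂ, τ • u = u) ∧ τ • s = t) : IsEmpty (k →+* K) := by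
  refine ⟨fun j => ?_⟩
  obtain ⟨s⟩ : Nonempty (K →+* ℂ) := inferInstance
  obtain ⟨τ, hτu, hτs⟩ := h s (ComplexEmbedding.conjugate s)
  have h1 : τ • (s.comp j) = s.comp j := hτu (s.comp j)
  have h2 : τ • (s.comp j) = (ComplexEmbedding.conjugate s).comp j := by
    rw [← hτs]; rfl
  have hreal : ComplexEmbedding.IsReal (s.comp j) := by
    rw [ComplexEmbedding.isReal_iff]
    refine RingHom.ext fun x => ?_
    have := RingHom.congr_fun (h1.symm.trans h2) x
    simp only [RingHom.comp_apply, ComplexEmbedding.conjugate_coe_eq] at this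
    rw [ComplexEmbedding.conjugate_coe_eq, RingHom.comp_apply]
    exact this.symm
  exact IsTotallyComplex.complexEmbedding_not_isReal (s.comp j) hreal

end Engine

end Literature.NumberTheory.ComplexMultiplication

end
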